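import Literature.Computability.AlgebraicComplexity.BI17TensorPolystabilityCriterion
import Literature.Computability.AlgebraicComplexity.BI17TensorFiniteStabilizerLocusProofs
import HarnessLib

/-!
# Bürgisser–Ikenmeyer 2017, Prop. 4.10 — an explicit generic tensor: polystable with trivial infinitesimal stabiliser

Topic `Literature/Computability/AlgebraicComplexity` (val-lit cell, programme #5 = discharge of the
cite-fact `Popov1970_genericClosedOrbit_tensor` / `BI2017_prop_4_10` by the Mumford route, brick T4;
sizing NOTE `HOME/bip/NOTE-t02g6-programme5-tensor-popov70-sizing.md`). One data definition
(`IK`-free, no named fact, no instance) and theorems.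

BI 2017 prove Prop. 4.10 ("almost all `w ∈ ⊗³ℂ^m` are polystable") by quoting Popov 1970 / Luna
1973 / Kraft 1984 (generic finite stabiliser ⇒ generic closed orbit). The tree's elementary route
(t09 g6: compactness `TensorOrbitClosedOfNoFixedTorus` + Nullstellensatz/Reynolds separation) needs,
for every `m ≥ 3`, ONE tensor `w₀` that is simultaneously POLYSTABLE (closed `SL_m³`-orbit) and OUTSIDE
the bad locus (zero traceless infinitesimal stabiliser, `HasTrivialSL3LieStabilizer`). This file
supplies it:

  `v_m := ∑_{i ∈ ℤ/m} 2·e_i⊗e_i⊗e_i + e_i⊗e_{i+1}⊗e_{i+2} + e_i⊗e_{i+2}⊗e_{i+1}`   (`m = n + 3`).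

* `IK`-style support lemmas: the support `{(i,i,i), (i,i+1,i+2), (i,i+2,i+1)}` is FREE in each leg
  (no two support points differ in exactly one slot) and every slot index carries exactly three
  support points — so t09 g5's criterion `isPolystableTensor_of_freeSupport_of_fullSupport`
  (BI 2017 Prop. 4.8, corrected) applies with the uniform weighting `1/(3m)`:
  **`isPolystableTensor_genericWitness`**.
* (brick T4b, appended separately) `hasTrivialSL3LieStabilizer_genericWitness`.

Honest framing: invariant theory of the toy model `⊗³ℂ^m`; VP ≠ VNP is NOT proved here and nothing in
this file bears on it. The coefficient `2` on the diagonal matters: with all coefficients `1` the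
tensor has a 4-dimensional infinitesimal stabiliser at `m = 3` (its support is then the whole plane
`a + b + c ≡ 0`).

## References
* [BurgisserIkenmeyer2017] P. Bürgisser, C. Ikenmeyer, *Fundamental invariants of orbit closures*,
  J. Algebra 477 (2017), Prop. 4.8 and Prop. 4.10 (TeX L1860–1936).
* [MumfordFogartyKirwan1994] D. Mumford, J. Fogarty, F. Kirwan, *Geometric Invariant Theory*, Ch. 2 §1.
-/

noncomputable section

open scoped BigOperators

namespace Literature.Computability.AlgebraicComplexity

section Witness

variable (n : ℕ)

/-- **The generic witness** `v_m = ∑_i 2·e_i⊗e_i⊗e_i + e_i⊗e_{i+1}⊗e_{i+2} + e_i⊗e_{i+2}⊗e_{i+1}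
∈ ⊗³ℂ^m`, `m = n + 3`, indices mod `m` (coordinates: `v_{abc} = 2[a=b=c] + [b=a+1, c=a+2] +
[b=a+2, c=a+1]`): a tensor with free support and uniform slot marginals (hence polystable) and zero
traceless infinitesimal stabiliser — the point `w₀` of the Mumford route to BI 2017 Prop. 4.10.
[cite: BurgisserIkenmeyer2017, Prop. 4.8 and Prop. 4.10 (proof)] -/
def genericWitness : Fin (n + 3) → Fin (n + 3) → Fin (n + 3) → ℂ := fun a b c =>
  (if a = b ∧ b = c then 2 else 0) + (if b = a + 1 ∧ c = a + 1 + 1 then 1 else 0) +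
    (if b = a + 1 + 1 ∧ c = a + 1 then 1 else 0)

/-- `1 ≠ 0`, `2 ≠ 0`, `1 ≠ 2` in `ℤ/(n+3)`, as shifts. [folklore] -/
private theorem shift_ne (a : Fin (n + 3)) : a + 1 ≠ a ∧ a + 1 + 1 ≠ a ∧ a + 1 + 1 ≠ a + 1 := by
  have hv1 : ((1 : Fin (n + 3)) : ℕ) = 1 := Fin.val_one _
  have hv2 : (((1 : Fin (n + 3)) + 1 : Fin (n + 3)) : ℕ) = 2 := by
    rw [Fin.val_add, hv1, Nat.mod_eq_of_lt (by omega)]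
  have h1 : (1 : Fin (n + 3)) ≠ 0 := fun h => by
    have := congrArg Fin.val h; rw [hv1, Fin.val_zero] at this; omega
  have h2 : (1 : Fin (n + 3)) + 1 ≠ 0 := fun h => by
    have := congrArg Fin.val h; rw [hv2, Fin.val_zero] at this; omega
  refine ⟨fun h => h1 ?_, fun h => h2 ?_, fun h => h1 ?_⟩
  · have : a + 1 = a + 0 := by rw [add_zero]; exact h
    exact add_left_cancel this
  · have : a + (1 + 1) = a + 0 := by rw [add_zero, ← add_assoc]; exact h
    exact add_left_cancel this
  · have : a + 1 + 1 = a + 1 + 0 := by rw [add_zero]; exact h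
    exact add_left_cancel this

/-- The three families of support points are pairwise disjoint; values `2, 1, 1, 0`.
[cite: BurgisserIkenmeyer2017, Prop. 4.10 (proof)] -/
theorem genericWitness_ne_zero_iff (a b c : Fin (n + 3)) :
    genericWitness n a b c ≠ 0 ↔
      (a = b ∧ b = c) ∨ (b = a + 1 ∧ c = a + 1 + 1) ∨ (b = a + 1 + 1 ∧ c = a + 1) := by
  obtain ⟨s1, s2, s12⟩ := shift_ne n a
  have e12 : a = b ∧ b = c → ¬ (b = a + 1 ∧ c = a + 1 + 1) := fun h h' => s1 (h.1.trans h'.1).symm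
  have e13 : a = b ∧ b = c → ¬ (b = a + 1 + 1 ∧ c = a + 1) := fun h h' => s2 (h.1.trans h'.1).symm
  have e23 : b = a + 1 ∧ c = a + 1 + 1 → ¬ (b = a + 1 + 1 ∧ c = a + 1) :=
    fun h h' => s12 (h.1.symm.trans h'.1).symm
  unfold genericWitness
  constructor
  · intro h
    by_contra hne
    push Not at hne
    obtain ⟨h1, h2, h3⟩ := hne
    apply h
    rw [if_neg (fun h' => h1 h'.1 h'.2), if_neg (fun h' => h2 h'.1 h'.2),
      if_neg (fun h' => h3 h'.1 h'.2)]
    norm_num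
  · rintro (h1 | h2 | h3)
    · rw [if_pos h1, if_neg (e12 h1), if_neg (e13 h1)]; norm_num
    · rw [if_pos h2, if_neg (fun h' => e12 h' h2), if_neg (e23 h2)]; norm_num
    · rw [if_pos h3, if_neg (fun h' => e13 h' h3), if_neg (fun h' => e23 h' h3)]; norm_num

/-- A double sum of the indicator of one point is `1`. [folklore] -/
private theorem sum_sum_indicator_eq_one (f : Fin (n + 3) → Fin (n + 3) → Prop)
    [∀ a b, Decidable (f a b)] (x y : Fin (n + 3)) (hf : ∀ a b, f a b ↔ a = x ∧ b = y) :
    ∑ a : Fin (n + 3), ∑ b : Fin (n + 3), (if f a b then (1 : ℚ) else 0) = 1 := by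
  have hre : ∀ a b, (if f a b then (1 : ℚ) else 0) = if a = x ∧ b = y then 1 else 0 :=
    fun a b => if_congr (hf a b) rfl rfl
  simp_rw [hre]
  rw [Finset.sum_eq_single x]
  · rw [Finset.sum_eq_single y]
    · simp
    · intro b _ hb; rw [if_neg (fun h => hb h.2)]
    · intro h; exact absurd (Finset.mem_univ y) h
  · intro a _ ha
    exact Finset.sum_eq_zero fun b _ => by rw [if_neg (fun h => ha h.1)]
  · intro h; exact absurd (Finset.mem_univ x) h

/-- **Brick T4a — the witness is polystable**: its `SL_m³`-orbit is closed, by t09 g5's free-support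
criterion (BI 2017 Prop. 4.8, corrected) with the uniform weighting `1/(3m)` on the `3m` support
points (each slot index lies on exactly three of them). [cite: BurgisserIkenmeyer2017, Prop. 4.8 and Prop. 4.10] -/
theorem isPolystableTensor_genericWitness : IsPolystableTensor (genericWitness n) := by
  classical
  set m := n + 3 with hm
  -- the weighting
  let α : Fin (n + 3) × Fin (n + 3) × Fin (n + 3) → ℚ := fun p =>
    (1 / (3 * (Fintype.card (Fin (n + 3)) : ℚ))) *
      ((if p.1 = p.2.1 ∧ p.2.1 = p.2.2 then 1 else 0) +
        (if p.2.1 = p.1 + 1 ∧ p.2.2 = p.1 + 1 + 1 then 1 else 0) +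
        (if p.2.1 = p.1 + 1 + 1 ∧ p.2.2 = p.1 + 1 then 1 else 0))
  have hcard : (Fintype.card (Fin (n + 3)) : ℚ) = n + 3 := by
    rw [Fintype.card_fin]; push_cast; ring
  have hpos3 : (0 : ℚ) < 1 / (3 * (Fintype.card (Fin (n + 3)) : ℚ)) := by
    rw [hcard]; positivity
  refine isPolystableTensor_of_freeSupport_of_fullSupport (genericWitness n) ?_ ?_ ?_ α ?_ ?_ ?_ ?_ ?_
  · -- free in the first leg: for fixed `(j, k)` at most one `i`
    intro i i' hii' j k
    by_contra h
    push Not at h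
    obtain ⟨h1, h2⟩ := h
    rw [genericWitness_ne_zero_iff] at h1 h2
    obtain ⟨_, _, s12⟩ := shift_ne n j
    have key : ∀ x : Fin (n + 3), ((x = j ∧ j = k) ∨ (j = x + 1 ∧ k = x + 1 + 1) ∨
        (j = x + 1 + 1 ∧ k = x + 1)) →
        (k = j ∧ x = j) ∨ (k = j + 1 ∧ x + 1 = j) ∨ (k + 1 = j ∧ x + 1 + 1 = j) := by
      rintro x (⟨rfl, rfl⟩ | ⟨hj, hk⟩ | ⟨hj, hk⟩)
      · exact Or.inl ⟨rfl, rfl⟩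
      · exact Or.inr (Or.inl ⟨by rw [hk, hj], hj.symm⟩)
      · exact Or.inr (Or.inr ⟨by rw [hk, hj], hj.symm⟩)
    obtain ⟨s1k, s2k, s12k⟩ := shift_ne n k
    obtain ⟨s1j, s2j, s12j⟩ := shift_ne n j
    rcases key i h1 with ⟨hk1, hx1⟩ | ⟨hk1, hx1⟩ | ⟨hk1, hx1⟩ <;>
      rcases key i' h2 with ⟨hk2, hx2⟩ | ⟨hk2, hx2⟩ | ⟨hk2, hx2⟩
    · exact hii' (hx1.trans hx2.symm)
    · exact s1j (hk2.symm.trans hk1)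
    · rw [hk1] at hk2; exact s1j hk2
    · exact s1j (hk1.symm.trans hk2)
    · exact hii' (add_right_cancel (hx1.trans hx2.symm))
    · rw [hk1] at hk2; exact s2j hk2
    · rw [hk2] at hk1; exact s1j hk1
    · rw [hk2] at hk1; exact s2j hk1
    · exact hii' (add_right_cancel (add_right_cancel (hx1.trans hx2.symm)))
  · -- free in the second leg: for fixed `(i, k)` at most one `j`
    intro j j' hjj' i k
    by_contra h
    push Not at h
    obtain ⟨h1, h2⟩ := h
    rw [genericWitness_ne_zero_iff] at h1 h2
    obtain ⟨s1, s2, s12⟩ := shift_ne n i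
    rcases h1 with ⟨hij, hjk⟩ | ⟨hj, hk⟩ | ⟨hj, hk⟩ <;> rcases h2 with ⟨hij', hjk'⟩ | ⟨hj', hk'⟩ | ⟨hj', hk'⟩
    · exact hjj' (hij.symm.trans hij')
    · rw [← hjk, ← hij] at hk'; exact s2 hk'.symm
    · rw [← hjk, ← hij] at hk'; exact s1 hk'.symm
    · rw [← hjk', ← hij'] at hk; exact s2 hk.symm
    · exact hjj' (hj.trans hj'.symm)
    · rw [hk] at hk'; exact s12 hk'
    · rw [← hjk', ← hij'] at hk; exact s1 hk.symm
    · rw [hk] at hk'; exact s12 hk'.symm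
    · exact hjj' (hj.trans hj'.symm)
  · -- free in the third leg: for fixed `(i, j)` at most one `k`
    intro k k' hkk' i j
    by_contra h
    push Not at h
    obtain ⟨h1, h2⟩ := h
    rw [genericWitness_ne_zero_iff] at h1 h2
    obtain ⟨s1, s2, s12⟩ := shift_ne n i
    rcases h1 with ⟨hij, hjk⟩ | ⟨hj, hk⟩ | ⟨hj, hk⟩ <;> rcases h2 with ⟨hij', hjk'⟩ | ⟨hj', hk'⟩ | ⟨hj', hk'⟩
    · exact hkk' (hjk.symm.trans hjk')
    · rw [← hij] at hj'; exact s1 hj'.symm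
    · rw [← hij] at hj'; exact s2 hj'.symm
    · rw [← hij'] at hj; exact s1 hj.symm
    · exact hkk' (hk.trans hk'.symm)
    · rw [hj] at hj'; exact s12 hj'.symm
    · rw [← hij'] at hj; exact s2 hj.symm
    · rw [hj] at hj'; exact s12 hj'
    · exact hkk' (hk.trans hk'.symm)
  · -- `α` vanishes off the support
    intro p hp
    rw [mem_tensorSupport, genericWitness_ne_zero_iff] at hp
    push Not at hp
    obtain ⟨h1, h2, h3⟩ := hp
    simp only [α]
    rw [if_neg (fun h => h1 h.1 h.2), if_neg (fun h => h2 h.1 h.2), if_neg (fun h => h3 h.1 h.2)]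
    ring
  · -- `α` is positive on the support
    intro p hp
    rw [mem_tensorSupport, genericWitness_ne_zero_iff] at hp
    simp only [α]
    refine mul_pos hpos3 ?_
    rcases hp with h | h | h
    · rw [if_pos h]; positivity
    · rw [if_pos h]
      have : (0 : ℚ) ≤ (if p.1 = p.2.1 ∧ p.2.1 = p.2.2 then (1 : ℚ) else 0) := by positivity
      have : (0 : ℚ) ≤ (if p.2.1 = p.1 + 1 + 1 ∧ p.2.2 = p.1 + 1 then (1 : ℚ) else 0) := by positivity
      linarith
    · rw [if_pos h]
      have : (0 : ℚ) ≤ (if p.1 = p.2.1 ∧ p.2.1 = p.2.2 then (1 : ℚ) else 0) := by positivity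
      have : (0 : ℚ) ≤ (if p.2.1 = p.1 + 1 ∧ p.2.2 = p.1 + 1 + 1 then (1 : ℚ) else 0) := by positivity
      linarith
  · -- first-slot marginals: three support points `(i,i,i), (i,i+1,i+2), (i,i+2,i+1)`
    intro i
    simp only [α, ← Finset.mul_sum, Finset.sum_add_distrib]
    rw [sum_sum_indicator_eq_one n (fun j l => i = j ∧ j = l) i i (fun a b =>
          ⟨fun ⟨h1, h2⟩ => ⟨h1.symm, h2.symm.trans h1.symm⟩, fun ⟨h1, h2⟩ => ⟨h1.symm, h1.trans h2.symm⟩⟩),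
      sum_sum_indicator_eq_one n (fun j l => j = i + 1 ∧ l = i + 1 + 1) (i + 1) (i + 1 + 1)
        (fun a b => Iff.rfl),
      sum_sum_indicator_eq_one n (fun j l => j = i + 1 + 1 ∧ l = i + 1) (i + 1 + 1) (i + 1)
        (fun a b => Iff.rfl), hcard]
    field_simp
    ring
  · -- second-slot marginals: `(j,j,j), (j-1,j,j+1), (j-2,j,j-1)`
    intro j
    simp only [α, ← Finset.mul_sum, Finset.sum_add_distrib]
    have hs1 : ∀ i : Fin (n + 3), j = i + 1 ↔ i = j - 1 := fun i => by
      rw [eq_sub_iff_add_eq]; exact ⟨fun h => h.symm, fun h => h.symm⟩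
    have hs2 : ∀ i : Fin (n + 3), j = i + 1 + 1 ↔ i = j - 1 - 1 := fun i => by
      rw [eq_sub_iff_add_eq, eq_sub_iff_add_eq]; exact ⟨fun h => h.symm, fun h => h.symm⟩
    rw [sum_sum_indicator_eq_one n (fun i l => i = j ∧ j = l) j j (fun a b =>
          ⟨fun ⟨h1, h2⟩ => ⟨h1, h2.symm⟩, fun ⟨h1, h2⟩ => ⟨h1, h2.symm⟩⟩),
      sum_sum_indicator_eq_one n (fun i l => j = i + 1 ∧ l = i + 1 + 1) (j - 1) (j - 1 + 1 + 1)
        (fun a b => ⟨fun ⟨h1, h2⟩ => ⟨(hs1 a).mp h1, by rw [← (hs1 a).mp h1]; exact h2⟩,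
          fun ⟨h1, h2⟩ => ⟨(hs1 a).mpr h1, by rw [h1]; exact h2⟩⟩),
      sum_sum_indicator_eq_one n (fun i l => j = i + 1 + 1 ∧ l = i + 1) (j - 1 - 1) (j - 1 - 1 + 1)
        (fun a b => ⟨fun ⟨h1, h2⟩ => ⟨(hs2 a).mp h1, by rw [← (hs2 a).mp h1]; exact h2⟩,
          fun ⟨h1, h2⟩ => ⟨(hs2 a).mpr h1, by rw [h1]; exact h2⟩⟩), hcard]
    field_simp
    ring
  · -- third-slot marginals: `(l,l,l), (l-2,l-1,l), (l-1,l+1,l)`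
    intro l
    simp only [α, ← Finset.mul_sum, Finset.sum_add_distrib]
    have hs1 : ∀ i : Fin (n + 3), l = i + 1 ↔ i = l - 1 := fun i => by
      rw [eq_sub_iff_add_eq]; exact ⟨fun h => h.symm, fun h => h.symm⟩
    have hs2 : ∀ i : Fin (n + 3), l = i + 1 + 1 ↔ i = l - 1 - 1 := fun i => by
      rw [eq_sub_iff_add_eq, eq_sub_iff_add_eq]; exact ⟨fun h => h.symm, fun h => h.symm⟩
    rw [sum_sum_indicator_eq_one n (fun i j => i = j ∧ j = l) l l (fun a b =>
          ⟨fun ⟨h1, h2⟩ => ⟨h1.trans h2, h2⟩, fun ⟨h1, h2⟩ => ⟨h1.trans h2.symm, h2⟩⟩),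
      sum_sum_indicator_eq_one n (fun i j => j = i + 1 ∧ l = i + 1 + 1) (l - 1 - 1) (l - 1 - 1 + 1)
        (fun a b => ⟨fun ⟨h1, h2⟩ => ⟨(hs2 a).mp h2, by rw [← (hs2 a).mp h2]; exact h1⟩,
          fun ⟨h1, h2⟩ => ⟨by rw [h1]; exact h2, (hs2 a).mpr h1⟩⟩),
      sum_sum_indicator_eq_one n (fun i j => j = i + 1 + 1 ∧ l = i + 1) (l - 1) (l - 1 + 1 + 1)
        (fun a b => ⟨fun ⟨h1, h2⟩ => ⟨(hs1 a).mp h2, by rw [← (hs1 a).mp h2]; exact h1⟩,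
          fun ⟨h1, h2⟩ => ⟨by rw [h1]; exact h2, (hs1 a).mpr h1⟩⟩), hcard]
    field_simp
    ring

end Witness

/-! ## Brick T4b — the witness has zero traceless infinitesimal stabiliser (`m ≥ 5`) -/

section LieStabilizer

variable (n : ℕ)

/-- `(X ⊗ 1 ⊗ 1)·v_m` in coordinates. [folklore] -/
private theorem actTensor_fst_genericWitness (X : Matrix (Fin (n + 3)) (Fin (n + 3)) ℂ)
    (a b c : Fin (n + 3)) :
    actTensor X (1 : Matrix (Fin (n + 3)) (Fin (n + 3)) ℂ) (1 : Matrix (Fin (n + 3)) (Fin (n + 3)) ℂ)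
        (genericWitness n) a b c =
      (if b = c then 2 * X a b else 0) + (if c = b + 1 then X a (b - 1) else 0) +
        (if b = c + 1 then X a (c - 1) else 0) := by
  rw [actTensor_fst_apply]
  simp only [genericWitness, mul_add, Finset.sum_add_distrib]
  have h1 : ∑ a', X a a' * (if a' = b ∧ b = c then (2 : ℂ) else 0) =
      if b = c then 2 * X a b else 0 := by
    rw [Finset.sum_eq_single b]
    · by_cases h : b = c <;> simp [h, mul_comm]
    · intro k _ hk; simp [hk]
    · intro h; exact absurd (Finset.mem_univ b) h
  have h2 : ∑ a', X a a' * (if b = a' + 1 ∧ c = a' + 1 + 1 then (1 : ℂ) else 0) =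
      if c = b + 1 then X a (b - 1) else 0 := by
    rw [Finset.sum_eq_single (b - 1)]
    · rw [sub_add_cancel]; by_cases h : c = b + 1 <;> simp [h]
    · intro k _ hk
      have : ¬ (b = k + 1 ∧ c = k + 1 + 1) := fun h' => hk (eq_sub_of_add_eq h'.1.symm)
      simp [this]
    · intro h; exact absurd (Finset.mem_univ (b - 1)) h
  have h3 : ∑ a', X a a' * (if b = a' + 1 + 1 ∧ c = a' + 1 then (1 : ℂ) else 0) =
      if b = c + 1 then X a (c - 1) else 0 := by
    rw [Finset.sum_eq_single (c - 1)]
    · rw [sub_add_cancel]; by_cases h : b = c + 1 <;> simp [h]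
    · intro k _ hk
      have : ¬ (b = k + 1 + 1 ∧ c = k + 1) := fun h' => hk (eq_sub_of_add_eq h'.2.symm)
      simp [this]
    · intro h; exact absurd (Finset.mem_univ (c - 1)) h
  rw [h1, h2, h3]

/-- `(1 ⊗ Y ⊗ 1)·v_m` in coordinates. [folklore] -/
private theorem actTensor_snd_genericWitness (Y : Matrix (Fin (n + 3)) (Fin (n + 3)) ℂ)
    (a b c : Fin (n + 3)) :
    actTensor (1 : Matrix (Fin (n + 3)) (Fin (n + 3)) ℂ) Y (1 : Matrix (Fin (n + 3)) (Fin (n + 3)) ℂ)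
        (genericWitness n) a b c =
      (if a = c then 2 * Y b a else 0) + (if c = a + 1 + 1 then Y b (a + 1) else 0) +
        (if c = a + 1 then Y b (a + 1 + 1) else 0) := by
  rw [actTensor_snd_apply]
  simp only [genericWitness, mul_add, Finset.sum_add_distrib]
  have h1 : ∑ b', Y b b' * (if a = b' ∧ b' = c then (2 : ℂ) else 0) =
      if a = c then 2 * Y b a else 0 := by
    rw [Finset.sum_eq_single a]
    · by_cases h : a = c <;> simp [h, mul_comm]
    · intro k _ hk; simp [Ne.symm hk]
    · intro h; exact absurd (Finset.mem_univ a) h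
  have h2 : ∑ b', Y b b' * (if b' = a + 1 ∧ c = a + 1 + 1 then (1 : ℂ) else 0) =
      if c = a + 1 + 1 then Y b (a + 1) else 0 := by
    rw [Finset.sum_eq_single (a + 1)]
    · by_cases h : c = a + 1 + 1 <;> simp [h]
    · intro k _ hk; simp [hk]
    · intro h; exact absurd (Finset.mem_univ (a + 1)) h
  have h3 : ∑ b', Y b b' * (if b' = a + 1 + 1 ∧ c = a + 1 then (1 : ℂ) else 0) =
      if c = a + 1 then Y b (a + 1 + 1) else 0 := by
    rw [Finset.sum_eq_single (a + 1 + 1)]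
    · by_cases h : c = a + 1 <;> simp [h]
    · intro k _ hk; simp [hk]
    · intro h; exact absurd (Finset.mem_univ (a + 1 + 1)) h
  rw [h1, h2, h3]

/-- `(1 ⊗ 1 ⊗ Z)·v_m` in coordinates. [folklore] -/
private theorem actTensor_thd_genericWitness (Z : Matrix (Fin (n + 3)) (Fin (n + 3)) ℂ)
    (a b c : Fin (n + 3)) :
    actTensor (1 : Matrix (Fin (n + 3)) (Fin (n + 3)) ℂ) (1 : Matrix (Fin (n + 3)) (Fin (n + 3)) ℂ) Z
        (genericWitness n) a b c =
      (if a = b then 2 * Z c b else 0) + (if b = a + 1 then Z c (a + 1 + 1) else 0) +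
        (if b = a + 1 + 1 then Z c (a + 1) else 0) := by
  rw [actTensor_thd_apply]
  simp only [genericWitness, mul_add, Finset.sum_add_distrib]
  have h1 : ∑ c', Z c c' * (if a = b ∧ b = c' then (2 : ℂ) else 0) =
      if a = b then 2 * Z c b else 0 := by
    rw [Finset.sum_eq_single b]
    · by_cases h : a = b <;> simp [h, mul_comm]
    · intro k _ hk; simp [Ne.symm hk]
    · intro h; exact absurd (Finset.mem_univ b) h
  have h2 : ∑ c', Z c c' * (if b = a + 1 ∧ c' = a + 1 + 1 then (1 : ℂ) else 0) =
      if b = a + 1 then Z c (a + 1 + 1) else 0 := by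
    rw [Finset.sum_eq_single (a + 1 + 1)]
    · by_cases h : b = a + 1 <;> simp [h]
    · intro k _ hk; simp [hk]
    · intro h; exact absurd (Finset.mem_univ (a + 1 + 1)) h
  have h3 : ∑ c', Z c c' * (if b = a + 1 + 1 ∧ c' = a + 1 then (1 : ℂ) else 0) =
      if b = a + 1 + 1 then Z c (a + 1) else 0 := by
    rw [Finset.sum_eq_single (a + 1)]
    · by_cases h : b = a + 1 + 1 <;> simp [h]
    · intro k _ hk; simp [hk]
    · intro h; exact absurd (Finset.mem_univ (a + 1)) h
  rw [h1, h2, h3]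

/-- **The infinitesimal action on `v_m`, in coordinates** — the nine-term formula
`((X ⊗ 1 ⊗ 1 + 1 ⊗ Y ⊗ 1 + 1 ⊗ 1 ⊗ Z)·v_m)_{abc} = 2[b=c]X_{ab} + [c=b+1]X_{a,b-1} + [b=c+1]X_{a,c-1}
+ 2[a=c]Y_{ba} + [c=a+2]Y_{b,a+1} + [c=a+1]Y_{b,a+2} + 2[a=b]Z_{cb} + [b=a+1]Z_{c,a+2} + [b=a+2]Z_{c,a+1}`.
[cite: BurgisserIkenmeyer2017, §4.1 (infinitesimal form of the stabiliser equation)] -/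
theorem lieAction_genericWitness_apply (X Y Z : Matrix (Fin (n + 3)) (Fin (n + 3)) ℂ)
    (a b c : Fin (n + 3)) :
    (actTensor X (1 : Matrix (Fin (n + 3)) (Fin (n + 3)) ℂ) (1 : Matrix (Fin (n + 3)) (Fin (n + 3)) ℂ)
          (genericWitness n) +
        actTensor (1 : Matrix (Fin (n + 3)) (Fin (n + 3)) ℂ) Y (1 : Matrix (Fin (n + 3)) (Fin (n + 3)) ℂ)
          (genericWitness n) +
        actTensor (1 : Matrix (Fin (n + 3)) (Fin (n + 3)) ℂ) (1 : Matrix (Fin (n + 3)) (Fin (n + 3)) ℂ) Z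
          (genericWitness n)) a b c =
      (if b = c then 2 * X a b else 0) + (if c = b + 1 then X a (b - 1) else 0) +
          (if b = c + 1 then X a (c - 1) else 0) +
        ((if a = c then 2 * Y b a else 0) + (if c = a + 1 + 1 then Y b (a + 1) else 0) +
          (if c = a + 1 then Y b (a + 1 + 1) else 0)) +
        ((if a = b then 2 * Z c b else 0) + (if b = a + 1 then Z c (a + 1 + 1) else 0) +
          (if b = a + 1 + 1 then Z c (a + 1) else 0)) := by
  simp only [Pi.add_apply, actTensor_fst_genericWitness, actTensor_snd_genericWitness,
    actTensor_thd_genericWitness]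

/-- **Brick T4b (`m ≥ 5`) — the witness `v_m` has zero traceless infinitesimal stabiliser**, by the
elimination described in the sizing note: the entries of `X, Y, Z` off the diagonal and the first
superdiagonal die one pattern at a time (`(a,b,b)`, `(a,b,a)`, `(a,b,a+1)`, `(b,b,c)`, `(a,a+1,c)`,
`(a,a+3,a+4)`, `(b+1,b,b+1)`, `(c+1,c+1,c)`, `(a,a+1,a+1)`), and the diagonal system
`x_a + y_a + z_a = x_a + y_{a+1} + z_{a+2} = x_a + y_{a+2} + z_{a+1} = 0` with zero traces forces
`y - z` to be shift-invariant (hence `0`) and then `d_a = y_{a+1} - y_a` to satisfy `d_{a+1} = -2 d_a`,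
so `((-2)^m - 1) d = 0`, `d = 0`, `y` constant, `y = 0`. The hypothesis `2 ≤ n` (`m ≥ 5`) makes the
shifts `1, 2, 3, 4` non-zero mod `m`; `m = 3, 4` are certificate cases (brick T4b-small).
[cite: BurgisserIkenmeyer2017, Thm. 4.2 and Prop. 4.10 (proof)] -/
theorem hasTrivialSL3LieStabilizer_genericWitness_of_two_le (hn : 2 ≤ n) :
    HasTrivialSL3LieStabilizer (genericWitness n) := by
  intro X Y Z hX hY hZ hL
  -- shifts `1, 2, 3, 4 ≠ 0` in `ℤ/(n+3)`
  have hv1 : ((1 : Fin (n + 3)) : ℕ) = 1 := Fin.val_one _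
  have hv2 : (((1 : Fin (n + 3)) + 1 : Fin (n + 3)) : ℕ) = 2 := by
    rw [Fin.val_add, hv1, Nat.mod_eq_of_lt (by omega)]
  have hv3 : (((1 : Fin (n + 3)) + 1 + 1 : Fin (n + 3)) : ℕ) = 3 := by
    rw [Fin.val_add, hv2, hv1, Nat.mod_eq_of_lt (by omega)]
  have hv4 : (((1 : Fin (n + 3)) + 1 + 1 + 1 : Fin (n + 3)) : ℕ) = 4 := by
    rw [Fin.val_add, hv3, hv1, Nat.mod_eq_of_lt (by omega)]
  have k1 : (1 : Fin (n + 3)) ≠ 0 := fun h => by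
    have := congrArg Fin.val h; rw [hv1, Fin.val_zero] at this; omega
  have k2 : (1 : Fin (n + 3)) + 1 ≠ 0 := fun h => by
    have := congrArg Fin.val h; rw [hv2, Fin.val_zero] at this; omega
  have k3 : (1 : Fin (n + 3)) + 1 + 1 ≠ 0 := fun h => by
    have := congrArg Fin.val h; rw [hv3, Fin.val_zero] at this; omega
  have k4 : (1 : Fin (n + 3)) + 1 + 1 + 1 ≠ 0 := fun h => by
    have := congrArg Fin.val h; rw [hv4, Fin.val_zero] at this; omega
  have s1 : ∀ x : Fin (n + 3), x + 1 ≠ x := fun x h => k1 (by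
    have : x + 1 = x + 0 := by rw [add_zero]; exact h
    exact add_left_cancel this)
  have s2 : ∀ x : Fin (n + 3), x + 1 + 1 ≠ x := fun x h => k2 (by
    have : x + (1 + 1) = x + 0 := by rw [add_zero, ← add_assoc]; exact h
    exact add_left_cancel this)
  have s3 : ∀ x : Fin (n + 3), x + 1 + 1 + 1 ≠ x := fun x h => k3 (by
    have : x + (1 + 1 + 1) = x + 0 := by rw [add_zero, ← add_assoc, ← add_assoc]; exact h
    exact add_left_cancel this)
  have s4 : ∀ x : Fin (n + 3), x + 1 + 1 + 1 + 1 ≠ x := fun x h => k4 (by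
    have : x + (1 + 1 + 1 + 1) = x + 0 := by
      rw [add_zero, ← add_assoc, ← add_assoc, ← add_assoc]; exact h
    exact add_left_cancel this)
  have s1' : ∀ x : Fin (n + 3), x ≠ x + 1 := fun x h => s1 x h.symm
  have s2' : ∀ x : Fin (n + 3), x ≠ x + 1 + 1 := fun x h => s2 x h.symm
  have s3' : ∀ x : Fin (n + 3), x ≠ x + 1 + 1 + 1 := fun x h => s3 x h.symm
  have s4' : ∀ x : Fin (n + 3), x ≠ x + 1 + 1 + 1 + 1 := fun x h => s4 x h.symm
  -- the nine-term equations
  have E : ∀ a b c : Fin (n + 3),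
      (if b = c then 2 * X a b else 0) + (if c = b + 1 then X a (b - 1) else 0) +
          (if b = c + 1 then X a (c - 1) else 0) +
        ((if a = c then 2 * Y b a else 0) + (if c = a + 1 + 1 then Y b (a + 1) else 0) +
          (if c = a + 1 then Y b (a + 1 + 1) else 0)) +
        ((if a = b then 2 * Z c b else 0) + (if b = a + 1 then Z c (a + 1 + 1) else 0) +
          (if b = a + 1 + 1 then Z c (a + 1) else 0)) = 0 := by
    intro a b c
    have h := congr_fun (congr_fun (congr_fun hL a) b) c
    rw [lieAction_genericWitness_apply] at h
    exact h
  -- Step 1: generic bands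
  have bX : ∀ a b, b ≠ a → b ≠ a + 1 → b ≠ a + 1 + 1 → X a b = 0 := by
    intro a b hba hb1 hb2
    have e := E a b b
    simp only [s1', if_false, if_true, add_zero, Ne.symm hba, hb1, hb2, mul_eq_zero,
      OfNat.ofNat_ne_zero, false_or] at e
    exact e
  have bY : ∀ b a, b ≠ a → b ≠ a + 1 → b ≠ a + 1 + 1 → a ≠ b + 1 → Y b a = 0 := by
    intro b a hba hb1 hb2 hab1
    have e := E a b a
    simp only [s1', s2', if_false, if_true, zero_add, add_zero, hba, Ne.symm hba, hb1, hb2, hab1,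
      mul_eq_zero, OfNat.ofNat_ne_zero, false_or] at e
    exact e
  have bY2 : ∀ b a, b ≠ a → b ≠ a + 1 → b ≠ a + 1 + 1 → Y b (a + 1 + 1) = 0 := by
    intro b a hba hb1 hb2
    have e := E a b (a + 1)
    simp only [s1', if_false, if_true, zero_add, add_zero, Ne.symm hba, hb1, hb2,
      add_left_inj] at e
    exact e
  have bZ : ∀ c b, c ≠ b → c ≠ b + 1 → c ≠ b + 1 + 1 → b ≠ c + 1 → Z c b = 0 := by
    intro c b hcb hc1 hc2 hbc1
    have e := E b b c
    simp only [s1', s2', if_false, if_true, zero_add, add_zero, Ne.symm hcb, hc1, hc2, hbc1,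
      mul_eq_zero, OfNat.ofNat_ne_zero, false_or] at e
    exact e
  have bZ2 : ∀ c a, c ≠ a → c ≠ a + 1 → c ≠ a + 1 + 1 → Z c (a + 1 + 1) = 0 := by
    intro c a hca hc1 hc2
    have e := E a (a + 1) c
    simp only [s1', if_false, if_true, zero_add, add_zero, Ne.symm hca, Ne.symm hc1, hc1, hc2,
      add_left_inj] at e
    exact e
  -- Step 2: `X_{a,a+2} = 0` from the pattern `(a, a+3, a+4)`
  have X2 : ∀ a, X a (a + 1 + 1) = 0 := by
    intro a
    have e := E a (a + 1 + 1 + 1) (a + 1 + 1 + 1 + 1)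
    simp only [s1, s1', s2, s2', s3, s3', s4', if_false, if_true, zero_add, add_zero,
      add_sub_cancel_right] at e
    exact e
  have Xoff : ∀ a b, b ≠ a → b ≠ a + 1 → X a b = 0 := by
    intro a b hba hb1
    by_cases hb2 : b = a + 1 + 1
    · rw [hb2]; exact X2 a
    · exact bX a b hba hb1 hb2
  have Yoff : ∀ b a, a ≠ b → a ≠ b + 1 → Y b a = 0 := by
    intro b a hab hab1
    by_cases hab2 : a = b + 1 + 1
    · rw [hab2]
      exact bY b (b + 1 + 1) (s2' b) (s3' b) (s4' b) (s1 (b + 1))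
    · have ha : a - 1 - 1 + 1 + 1 = a := by rw [sub_add_cancel, sub_add_cancel]
      rw [← ha]
      refine bY2 b (a - 1 - 1) ?_ ?_ ?_
      · intro h; exact hab2 (by rw [h, sub_add_cancel, sub_add_cancel])
      · intro h; exact hab1 (by rw [h, sub_add_cancel, sub_add_cancel])
      · rw [ha]; exact Ne.symm hab
  have Zoff : ∀ c b, b ≠ c → b ≠ c + 1 → Z c b = 0 := by
    intro c b hbc hbc1
    by_cases hbc2 : b = c + 1 + 1
    · rw [hbc2]
      exact bZ c (c + 1 + 1) (s2' c) (s3' c) (s4' c) (s1 (c + 1))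
    · have hb : b - 1 - 1 + 1 + 1 = b := by rw [sub_add_cancel, sub_add_cancel]
      rw [← hb]
      refine bZ2 c (b - 1 - 1) ?_ ?_ ?_
      · intro h; exact hbc2 (by rw [h, sub_add_cancel, sub_add_cancel])
      · intro h; exact hbc1 (by rw [h, sub_add_cancel, sub_add_cancel])
      · rw [hb]; exact Ne.symm hbc
  have hXsub : ∀ b, X (b + 1) (b - 1) = 0 := by
    intro b
    refine Xoff (b + 1) (b - 1) ?_ ?_
    · intro h; exact s2 (b - 1) (by rw [sub_add_cancel] ; exact h.symm)
    · intro h; exact s3 (b - 1) (by rw [sub_add_cancel]; exact h.symm)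
  -- Step 3: the first superdiagonals
  have Y1 : ∀ b, Y b (b + 1) = 0 := by
    intro b
    have e := E (b + 1) b (b + 1)
    simp only [s1, s1', s2', s3', if_false, if_true, zero_add, add_zero, hXsub,
      mul_eq_zero, OfNat.ofNat_ne_zero, false_or] at e
    exact e
  have Z1 : ∀ c, Z c (c + 1) = 0 := by
    intro c
    have e := E (c + 1) (c + 1) c
    simp only [s1, s1', s2', s3', if_false, if_true, zero_add, add_zero, hXsub,
      mul_eq_zero, OfNat.ofNat_ne_zero, false_or] at e
    exact e
  have X1 : ∀ a, X a (a + 1) = 0 := by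
    intro a
    have e := E a (a + 1) (a + 1)
    simp only [s1', if_false, if_true, add_zero, Y1, Z1, mul_eq_zero, OfNat.ofNat_ne_zero,
      false_or] at e
    exact e
  -- Step 4: the diagonal system
  have D0 : ∀ a, X a a + Y a a + Z a a = 0 := by
    intro a
    have e := E a a a
    simp only [s1', s2', if_false, if_true, add_zero] at e
    linear_combination e / 2
  have D1 : ∀ a, X a a + Y (a + 1) (a + 1) + Z (a + 1 + 1) (a + 1 + 1) = 0 := by
    intro a
    have e := E a (a + 1) (a + 1 + 1)
    simp only [s1, s1', s2', if_false, if_true, zero_add, add_zero, add_sub_cancel_right] at e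
    exact e
  have D2 : ∀ a, X a a + Y (a + 1 + 1) (a + 1 + 1) + Z (a + 1) (a + 1) = 0 := by
    intro a
    have e := E a (a + 1 + 1) (a + 1)
    simp only [s1, s1', s2', if_false, if_true, zero_add, add_zero, add_sub_cancel_right] at e
    linear_combination e
  -- traces
  have tX : ∑ i, X i i = 0 := hX
  have tY : ∑ i, Y i i = 0 := hY
  have tZ : ∑ i, Z i i = 0 := hZ
  -- `u = y - z` is shift-invariant, hence zero
  have hu : ∀ b, Y (b + 1) (b + 1) - Z (b + 1) (b + 1) = Y b b - Z b b := by
    intro b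
    have h1 := D1 (b - 1)
    have h2 := D2 (b - 1)
    rw [sub_add_cancel] at h1 h2
    linear_combination h2 - h1
  have hu0 : ∀ b : Fin (n + 3), Y b b - Z b b = Y 0 0 - Z 0 0 := by
    intro b
    induction b using Fin.induction with
    | zero => rfl
    | succ i ih => rw [← Fin.coeSucc_eq_succ, hu, ih]
  have hYZ : ∀ b, Y b b = Z b b := by
    have hsum : ∑ b : Fin (n + 3), (Y b b - Z b b) = (n + 3 : ℕ) • (Y 0 0 - Z 0 0) := by
      rw [Finset.sum_congr rfl fun b _ => hu0 b, Finset.sum_const, Finset.card_univ,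
        Fintype.card_fin]
    rw [Finset.sum_sub_distrib, tY, tZ, sub_zero, nsmul_eq_mul] at hsum
    have h0 : Y 0 0 - Z 0 0 = 0 := by
      have hne : ((n + 3 : ℕ) : ℂ) ≠ 0 := Nat.cast_ne_zero.mpr (by omega)
      exact (mul_eq_zero.mp hsum.symm).resolve_left hne
    intro b
    exact sub_eq_zero.mp ((hu0 b).trans h0)
  -- `d_a = y_{a+1} - y_a` satisfies `d_{a+1} = -2 d_a`
  have hrec : ∀ a, Y (a + 1 + 1) (a + 1 + 1) = 2 * Y a a - Y (a + 1) (a + 1) := by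
    intro a
    have h0 := D0 a
    have h1 := D1 a
    rw [← hYZ] at h0 h1
    linear_combination h1 - h0
  have hd : ∀ a, Y (a + 1 + 1) (a + 1 + 1) - Y (a + 1) (a + 1) = -2 * (Y (a + 1) (a + 1) - Y a a) := by
    intro a; rw [hrec]; ring
  have hiter : ∀ (k : ℕ) (a : Fin (n + 3)),
      Y (a + k • (1 : Fin (n + 3)) + 1) (a + k • (1 : Fin (n + 3)) + 1) -
          Y (a + k • (1 : Fin (n + 3))) (a + k • (1 : Fin (n + 3))) =
        (-2) ^ k * (Y (a + 1) (a + 1) - Y a a) := by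
    intro k
    induction k with
    | zero => intro a; rw [zero_nsmul, add_zero, pow_zero, one_mul]
    | succ k ih =>
      intro a
      have hk : a + (k + 1) • (1 : Fin (n + 3)) = a + k • (1 : Fin (n + 3)) + 1 := by
        rw [succ_nsmul, add_assoc]
      rw [hk, hd, ih, pow_succ]
      ring
  have hper : (n + 3) • (1 : Fin (n + 3)) = 0 := by
    have h := card_nsmul_eq_zero (G := Fin (n + 3)) (x := (1 : Fin (n + 3)))
    rwa [Fintype.card_fin] at h
  have hpow : ((-2 : ℂ)) ^ (n + 3) ≠ 1 := by
    intro h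
    have h' := congrArg (fun z : ℂ => ‖z‖) h
    simp only [norm_pow, norm_neg, norm_one] at h'
    have h2 : ‖(2 : ℂ)‖ = 2 := by simp
    rw [h2] at h'
    have : (1 : ℝ) < (2 : ℝ) ^ (n + 3) := one_lt_pow₀ (by norm_num) (by omega)
    linarith
  have hdz : ∀ a, Y (a + 1) (a + 1) - Y a a = 0 := by
    intro a
    have h := hiter (n + 3) a
    rw [hper, add_zero] at h
    -- `d a = (-2)^(n+3) d a`
    have : ((-2 : ℂ) ^ (n + 3) - 1) * (Y (a + 1) (a + 1) - Y a a) = 0 := by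
      linear_combination -h
    exact (mul_eq_zero.mp this).resolve_left (sub_ne_zero.mpr hpow)
  have hY0 : ∀ b : Fin (n + 3), Y b b = Y 0 0 := by
    intro b
    induction b using Fin.induction with
    | zero => rfl
    | succ i ih => rw [← Fin.coeSucc_eq_succ, ← ih]; exact sub_eq_zero.mp (hdz _)
  have hYd : ∀ b, Y b b = 0 := by
    have hsum : ∑ b : Fin (n + 3), Y b b = (n + 3 : ℕ) • Y 0 0 := by
      rw [Finset.sum_congr rfl fun b _ => hY0 b, Finset.sum_const, Finset.card_univ,
        Fintype.card_fin]
    rw [tY, nsmul_eq_mul] at hsum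
    have hne : ((n + 3 : ℕ) : ℂ) ≠ 0 := Nat.cast_ne_zero.mpr (by omega)
    have h0 : Y 0 0 = 0 := (mul_eq_zero.mp hsum.symm).resolve_left hne
    intro b; rw [hY0, h0]
  have hZd : ∀ b, Z b b = 0 := fun b => by rw [← hYZ, hYd]
  have hXd : ∀ b, X b b = 0 := fun b => by
    have h := D0 b; rw [hYd, hZd, add_zero, add_zero] at h; exact h
  -- conclusion
  refine ⟨?_, ?_, ?_⟩
  · ext a b
    rw [Matrix.zero_apply]
    by_cases h0 : b = a
    · rw [h0]; exact hXd a
    · by_cases h1 : b = a + 1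
      · rw [h1]; exact X1 a
      · exact Xoff a b h0 h1
  · ext b a
    rw [Matrix.zero_apply]
    by_cases h0 : a = b
    · rw [h0]; exact hYd b
    · by_cases h1 : a = b + 1
      · rw [h1]; exact Y1 b
      · exact Yoff b a h0 h1
  · ext c b
    rw [Matrix.zero_apply]
    by_cases h0 : b = c
    · rw [h0]; exact hZd c
    · by_cases h1 : b = c + 1
      · rw [h1]; exact Z1 c
      · exact Zoff c b h0 h1

end LieStabilizer

end Literature.Computability.AlgebraicComplexity

end
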